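import Mathlib
import HarnessLib
import Literature.Probability.LatticeModels.IsingLimitLaw
import Literature.Probability.LatticeModels.IsingLimitLawTilt
import Literature.Probability.LatticeModels.IsingLimitLawLaplace
import Literature.Analysis.Complex.PolyaBesselKernel
import Summits.RiemannHypothesis.RiemannHypothesis.Theorems.LeeYangLeeyangPolyaKernelIsingLimitDefs

/-!
# The Bessel ratio `K₁/K₀` and the Riccati equation of the telegraph flip rate

Stub `stub_rate` of the line `telegraph-bessel-chain` (crux stmt-RiemannHypothesis-0453,
`Summit.RiemannHypothesis.RiemannHypothesis.Theses.LeeYang.LeeyangPolyaKernelIsingLimit`).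

With the tree's `G_n(v, w) = ∫ cosh(t)^n e^{−v cosh t} e^{iwt} dt`
(`Literature.Analysis.Complex.Polya1926.polyaG`; `G_0(v, 0) = 2K_0(v)`, `G_1(v, 0) = 2K_1(v)`)
write `g_n(v) = Re G_n(v, 0) = ∫ cosh(t)^n e^{−v cosh t} dt > 0` (`G_n(v, 0)` is real). We prove,
for the objects `besselRatio v = g_1(v)/g_0(v)` (`= K_1/K_0`) and
`flipRate a t = v · besselRatio v`, `v = a e^t`, of
`Theorems/LeeYangLeeyangPolyaKernelIsingLimitDefs.lean`:

* `G_0(v, 0) > 0` and `G_0(v, 0)`, `G_1(v, 0)` are real (`v > 0`);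
* `q := K_1/K_0 ≥ 1` (`cosh ≥ 1` under the integral);
* `q` is antitone on `(0, ∞)`: `g_n' = −g_{n+1}` (`hasDerivAt_polyaG`), so
  `q' = (g_1² − g_0 g_2)/g_0² ≤ 0` by the Cauchy–Schwarz inequality `g_1² ≤ g_0 g_2`
  (`0 ≤ ∫ (λ − cosh t)² e^{−v cosh t} dt` for every real `λ`, discriminant);
* the Riccati equation `r' = r² − v²` of `r = flipRate a`: Bessel's equation
  (`polyaG_ode` at `w = 0`) reads `g_2 = g_1/v + g_0`, whence `q' = q² − q/v − 1` and, with
  `dv/dt = v`, `r' = vq + v² q' = (vq)² − v²`.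

References: folklore (modified Bessel functions; M. Kac, Rocky Mountain J. Math. 4 (1974) for
the telegraph process); the kernel is that of G. Pólya, Acta Math. 48 (1926).
-/

noncomputable section

namespace Summit.RiemannHypothesis.RiemannHypothesis.Theorems.LeeYangTelegraph

open MeasureTheory Filter Topology Complex
open Literature.Probability.LatticeModels Literature.Analysis.Complex.Polya1926

/-! ### `G_n(v, 0)` is a positive real integral -/

/-- At `w = 0`, `G_n(v, 0) = ∫ cosh(t)^n e^{−v cosh t} dt` (a real number). [folklore] -/
theorem polyaG_at_zero (n : ℕ) (v : ℝ) :
    polyaG n v 0 = ((∫ t, polyaKernel n v t : ℝ) : ℂ) := by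
  rw [polyaG_eq, ← integral_complex_ofReal]
  refine integral_congr_ae (Eventually.of_forall fun t ↦ ?_)
  simp

/-- `Re G_n(v, 0) = ∫ cosh(t)^n e^{−v cosh t} dt`. [folklore] -/
theorem polyaG_at_zero_re (n : ℕ) (v : ℝ) : (polyaG n v 0).re = ∫ t, polyaKernel n v t := by
  rw [polyaG_at_zero, Complex.ofReal_re]

/-- `Im G_n(v, 0) = 0`. [folklore] -/
theorem polyaG_at_zero_im (n : ℕ) (v : ℝ) : (polyaG n v 0).im = 0 := by
  rw [polyaG_at_zero, Complex.ofReal_im]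

/-- The kernel `cosh(t)^n e^{−v cosh t}` is integrable for `v > 0`. [folklore] -/
theorem integrable_polyaKernel_real {v : ℝ} (hv : 0 < v) (n : ℕ) :
    Integrable (polyaKernel n v) := by
  simpa using integrable_polyaKernel_mul_exp hv n 0

/-- `g_n(v) = ∫ cosh(t)^n e^{−v cosh t} dt > 0` for `v > 0`. [folklore] -/
theorem polyaG_at_zero_re_pos {v : ℝ} (hv : 0 < v) (n : ℕ) : 0 < (polyaG n v 0).re := by
  rw [polyaG_at_zero_re]
  exact integral_pos_of_integrable_nonneg_nonzero (x := (0 : ℝ)) (continuous_polyaKernel n v)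
    (integrable_polyaKernel_real hv n) (fun t ↦ polyaKernel_nonneg n v t)
    (polyaKernel_pos n v 0).ne'

/-- `g_n ≤ g_{n+1}` (`cosh ≥ 1`). [folklore] -/
theorem polyaG_at_zero_re_le_succ {v : ℝ} (hv : 0 < v) (n : ℕ) :
    (polyaG n v 0).re ≤ (polyaG (n + 1) v 0).re := by
  rw [polyaG_at_zero_re, polyaG_at_zero_re]
  refine integral_mono (integrable_polyaKernel_real hv n) (integrable_polyaKernel_real hv (n + 1))
    fun t ↦ ?_
  rw [polyaKernel_succ]
  exact le_mul_of_one_le_left (polyaKernel_nonneg n v t) (Real.one_le_cosh t)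

/-- **Cauchy–Schwarz for the kernel moments**: `g_1² ≤ g_0 g_2`, from
`0 ≤ ∫ (λ − cosh t)² e^{−v cosh t} dt = λ² g_0 − 2λ g_1 + g_2` for all real `λ`. [folklore] -/
theorem polyaG_at_zero_re_sq_le {v : ℝ} (hv : 0 < v) :
    (polyaG 1 v 0).re ^ 2 ≤ (polyaG 0 v 0).re * (polyaG 2 v 0).re := by
  rw [polyaG_at_zero_re, polyaG_at_zero_re, polyaG_at_zero_re]
  have hi := integrable_polyaKernel_real hv
  have hquad : ∀ l : ℝ, 0 ≤ (∫ t, polyaKernel 0 v t) * (l * l) + (-2 * ∫ t, polyaKernel 1 v t) * l +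
      ∫ t, polyaKernel 2 v t := by
    intro l
    have hpt : ∀ t, (l - Real.cosh t) ^ 2 * polyaKernel 0 v t =
        l * l * polyaKernel 0 v t - 2 * l * polyaKernel 1 v t + polyaKernel 2 v t := by
      intro t
      simp only [polyaKernel]
      ring
    have h01 : Integrable fun t ↦ l * l * polyaKernel 0 v t - 2 * l * polyaKernel 1 v t :=
      ((hi 0).const_mul _).sub ((hi 1).const_mul _)
    have hint : ∫ t, (l - Real.cosh t) ^ 2 * polyaKernel 0 v t =
        (∫ t, polyaKernel 0 v t) * (l * l) + (-2 * ∫ t, polyaKernel 1 v t) * l +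
          ∫ t, polyaKernel 2 v t := by
      simp_rw [hpt]
      rw [integral_add h01 (hi 2), integral_sub ((hi 0).const_mul _) ((hi 1).const_mul _),
        integral_const_mul, integral_const_mul]
      ring
    rw [← hint]
    exact integral_nonneg fun t ↦ mul_nonneg (sq_nonneg _) (polyaKernel_nonneg 0 v t)
  have hd := discrim_le_zero hquad
  rw [discrim] at hd
  nlinarith [hd]

/-! ### Derivatives in `v` -/

/-- `g_n'(v) = −g_{n+1}(v)` (`v > 0`), the real part of `∂G_n/∂x = −G_{n+1}`. [folklore] -/
theorem hasDerivAt_polyaG_at_zero_re {v : ℝ} (hv : 0 < v) (n : ℕ) :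
    HasDerivAt (fun y ↦ (polyaG n y 0).re) (-(polyaG (n + 1) v 0).re) v := by
  have h : HasDerivAt (fun y ↦ (polyaG n y 0).re) (-polyaG (n + 1) v 0).re v :=
    Complex.reCLM.hasFDerivAt.comp_hasDerivAt v (hasDerivAt_polyaG hv n 0)
  exact h.congr_deriv (Complex.neg_re _)

/-- **Bessel's equation at `w = 0`**: `g_2(v) = g_1(v)/v + g_0(v)`, i.e.
`v² g_2 − v g_1 − v² g_0 = 0`. [folklore] -/
theorem polyaG_at_zero_re_two {v : ℝ} (hv : 0 < v) :
    (polyaG 2 v 0).re = (polyaG 1 v 0).re / v + (polyaG 0 v 0).re := by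
  have hode := congrArg Complex.re (polyaG_ode hv 0)
  simp only [Complex.add_re, Complex.sub_re, Complex.mul_re, polyaG_at_zero_im, mul_zero,
    sub_zero, Complex.zero_re, ← Complex.ofReal_pow, Complex.ofReal_re, zero_pow two_ne_zero,
    zero_sub, Complex.neg_re] at hode
  field_simp
  nlinarith [hode]

/-- `q'(v) = (g_1² − g_0 g_2)/g_0²` for `q = besselRatio = g_1/g_0` (`v > 0`). [folklore] -/
theorem hasDerivAt_besselRatio_quot {v : ℝ} (hv : 0 < v) :
    HasDerivAt besselRatio
      (((polyaG 1 v 0).re ^ 2 - (polyaG 0 v 0).re * (polyaG 2 v 0).re) / (polyaG 0 v 0).re ^ 2)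
      v := by
  have h := (hasDerivAt_polyaG_at_zero_re hv 1).div (hasDerivAt_polyaG_at_zero_re hv 0)
    (polyaG_at_zero_re_pos hv 0).ne'
  refine (h.congr_of_eventuallyEq (Eventually.of_forall fun y ↦ rfl)).congr_deriv ?_
  ring

/-- `q' ≤ 0` on `(0, ∞)`, by Cauchy–Schwarz. [folklore] -/
theorem deriv_besselRatio_nonpos {v : ℝ} (hv : 0 < v) :
    ((polyaG 1 v 0).re ^ 2 - (polyaG 0 v 0).re * (polyaG 2 v 0).re) / (polyaG 0 v 0).re ^ 2
      ≤ 0 :=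
  div_nonpos_of_nonpos_of_nonneg (sub_nonpos.2 (polyaG_at_zero_re_sq_le hv)) (sq_nonneg _)

/-- **The Riccati form** `q'(v) = q(v)² − q(v)/v − 1` (`v > 0`), from Bessel's equation.
[folklore] -/
theorem hasDerivAt_besselRatio {v : ℝ} (hv : 0 < v) :
    HasDerivAt besselRatio (besselRatio v ^ 2 - besselRatio v / v - 1) v := by
  refine (hasDerivAt_besselRatio_quot hv).congr_deriv ?_
  have hg0 := (polyaG_at_zero_re_pos hv 0).ne'
  rw [polyaG_at_zero_re_two hv, besselRatio]
  field_simp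
  ring

/-- `q = K_1/K_0 ≥ 1`. [folklore] -/
theorem one_le_besselRatio {v : ℝ} (hv : 0 < v) : 1 ≤ besselRatio v := by
  rw [besselRatio, one_le_div (polyaG_at_zero_re_pos hv 0)]
  exact polyaG_at_zero_re_le_succ hv 0

/-- `q = K_1/K_0` is antitone on `(0, ∞)`. [folklore] -/
theorem antitoneOn_besselRatio : AntitoneOn besselRatio (Set.Ioi 0) := by
  refine antitoneOn_of_hasDerivWithinAt_nonpos (convex_Ioi 0)
    (f' := fun v ↦
      ((polyaG 1 v 0).re ^ 2 - (polyaG 0 v 0).re * (polyaG 2 v 0).re) / (polyaG 0 v 0).re ^ 2)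
    (fun v hv ↦ (hasDerivAt_besselRatio_quot hv).continuousAt.continuousWithinAt)
    (fun v hv ↦ ?_) (fun v hv ↦ ?_)
  · rw [interior_Ioi] at hv ⊢
    exact (hasDerivAt_besselRatio_quot hv).hasDerivWithinAt
  · rw [interior_Ioi] at hv
    exact deriv_besselRatio_nonpos hv

/-- **The Riccati equation of the flip rate**: `r' = r² − v²` for `r(t) = flipRate a t`,
`v = a e^t` (`a > 0`). [folklore] -/
theorem hasDerivAt_flipRate {a : ℝ} (ha : 0 < a) (t : ℝ) :
    HasDerivAt (flipRate a) (flipRate a t ^ 2 - (a * Real.exp t) ^ 2) t := by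
  have hv : HasDerivAt (fun s ↦ a * Real.exp s) (a * Real.exp t) t := by
    simpa using (Real.hasDerivAt_exp t).const_mul a
  have hpos : 0 < a * Real.exp t := mul_pos ha (Real.exp_pos t)
  have hq := (hasDerivAt_besselRatio hpos).comp t hv
  have h : HasDerivAt (flipRate a) (a * Real.exp t * besselRatio (a * Real.exp t) +
      a * Real.exp t * ((besselRatio (a * Real.exp t) ^ 2 -
        besselRatio (a * Real.exp t) / (a * Real.exp t) - 1) * (a * Real.exp t))) t :=
    hv.mul hq
  refine h.congr_deriv ?_
  rw [flipRate]
  field_simp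
  ring

/-! ### The stub -/

/-- **The Bessel ratio** (stub `stub_rate` of the line `telegraph-bessel-chain`):
`G₀(v, 0) > 0` is real and `G₁(v, 0)` is real (`v > 0`); `q(v) = K₁(v)/K₀(v) ≥ 1` is antitone
on `(0, ∞)` (log-convexity of `K₀`, Cauchy–Schwarz); and the flip rate `r(t) = v q(v)`,
`v = ae^t`, satisfies the Riccati equation `r' = r² − v²` (Bessel's equation at `w = 0`).
[folklore] -/
theorem stub_rate (a : ℝ) (ha : 0 < a) :
    (∀ v : ℝ, 0 < v → 0 < (polyaG 0 v 0).re ∧ (polyaG 0 v 0).im = 0 ∧ (polyaG 1 v 0).im = 0) ∧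
    (∀ v : ℝ, 0 < v → 1 ≤ besselRatio v) ∧
    AntitoneOn besselRatio (Set.Ioi 0) ∧
    (∀ t : ℝ, HasDerivAt (flipRate a) (flipRate a t ^ 2 - (a * Real.exp t) ^ 2) t) :=
  ⟨fun v hv ↦ ⟨polyaG_at_zero_re_pos hv 0, polyaG_at_zero_im 0 v, polyaG_at_zero_im 1 v⟩,
    fun _ hv ↦ one_le_besselRatio hv, antitoneOn_besselRatio, hasDerivAt_flipRate ha⟩

end Summit.RiemannHypothesis.RiemannHypothesis.Theorems.LeeYangTelegraph

end
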